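import Literature.NumberTheory.DiophantineGeometry.GenEllDeDefectOrd
import Mathlib.RingTheory.DedekindDomain.IntegralClosure
import HarnessLib

/-!
# [GenEll] Thm 2.1 on the `D_e` route: the sharp conductor inequality with a DEFECT at EVERY place,
# from the ramification divisibility — no `p`-adic separation, no good reduction

Support file (proof-only, no definitions) for the abc-iut cell's route item `GenEllTwo`
(stmt-ABC-19679; [GenEll] = S. Mochizuki, *Arithmetic elliptic curves in general position*, Math. J.
Okayama Univ. **52** (2010), Thm. 2.1 (ii) ⇒ (i), proof pp. 12–13; package W5 «sharp Prop. 1.6 on the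
curve `D_e`», piece (F-b) of the cell's finding F3 / R-b-with-defects resolution).  Classical and
undisputed; nothing here bears on [IUTchIII] Cor. 3.12.

SETTING (family conventions `e = 2k+1`, parameter `c`): the curve `D_e : s² = 1 − 4r^{2k+1}`, the
function `t_c` with `t·(rs) = s + c·r^{k+2}`, the ramification form
`N_c = −s³ + c·((k+1)r^{k+2} − 2r^{3k+3})`, a finite set `A` of values (the critical values of `t_c`).
INPUT (hypothesis `hH`, produced by the Dedekind-ring divisibility `N_c ∣ ∏_{β∈A}(s + c r^{k+2} − β rs)`
in `K[r,s]/(s² − 1 + 4r^{2k+1})`, abc-iut-w5-d054's `GenEllDeCritDivisibility`): polynomials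
`H₀, H₁ ∈ K[X]` with `∏_{β∈A}(s + c·r^{k+2} − β·rs) = N_c·(H₀(r) + s·H₁(r))` at the point.
OUTPUT (`DeC.exists_defect_toNat_ord_le`): a constant `D` depending only on `(p, k, c, A, H₀, H₁)` such
that for EVERY number field `L ⊇ K`, EVERY finite place `w ∣ p` of `L` and EVERY point of
`D_e(L) ∖ {rs = 0}` with `N_c ≠ 0` and `t ∉ A`,

  `ord⁺_w N_c ≤ Σ_{β∈A} ord⁺_w (t − β) + D · e(w∣p)`.

No separation of the point from the ramification locus, no reduction hypothesis at `w`: the slope-1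
comparison `ord N ≤ ord(t − β) + O(1)` near a ramification point is carried by the identity (where
`rs` and `H` have bounded order), and away from the ramification locus `ord_w N_c` is bounded by a
dominant-term analysis of `N_c` on the curve (`r` large, `r` small, `s` small).  This is the input
`hdef`/`hδ` of the defect form of the conductor summation (`FibreConductorKappaDefect`,
abc-iut-w5-d009), which removes the bad primes from the place set of the compactness spine.
[cite: MochizukiGenEll2010, Thm 2.1 proof pp.12-13] [cite: BombieriGubler2006, §1.5]
-/

noncomputable section

open NumberField IsDedekindDomain Polynomial Finset
open Literature.IUT.LogVolume Literature.IUT.LogVolume.Cor22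

namespace Literature.NumberTheory.DiophantineGeometry.GenEll

namespace DeDefect

variable {L : Type*} [Field L] [NumberField L] (w : HeightOneSpectrum (𝓞 L))

/-! ## The curve `D_e`: pinning `ord_w r`, `ord_w s` when `ord_w N_c` is large -/

/-- If `ord_w r` is LARGE (beyond the denominator bound of `c`), then `N_c` is a `w`-unit:
`ord_w N_c = 0` (the point reduces onto `Q_0` or `Q_1`, where `N_c = ∓1`). [cite: MochizukiGenEll2010, Thm 2.1 proof pp.12-13] -/
theorem ord_N_eq_zero_of_ord_r_large (k : ℕ) {c r s N : L} {M E : ℤ} (hE : 0 ≤ E) (hM : 0 ≤ M)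
    (hcurve : s ^ 2 = 1 - 4 * r ^ (2 * k + 1))
    (hN : N = -s ^ 3 + c * ((k + 1) * r ^ (k + 2) - 2 * r ^ (3 * k + 3)))
    (hr : r ≠ 0) (hs : s ≠ 0) (hc : c ≠ 0) (hcl : -(M * E) ≤ ord L w c)
    (hρ : M * E < ord L w r) : ord L w N = 0 := by
  have hρpos : 0 < ord L w r := by nlinarith
  have h4 : (4 : L) ≠ 0 := by norm_num
  have h2 : (2 : L) ≠ 0 := by norm_num
  have hk1 : ((k : L) + 1) ≠ 0 := by exact_mod_cast Nat.succ_ne_zero k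
  have o4 : 0 ≤ ord L w (4 : L) := by simpa using ord_natCast_nonneg w 4
  have o2 : 0 ≤ ord L w (2 : L) := by simpa using ord_natCast_nonneg w 2
  have ok1 : 0 ≤ ord L w ((k : L) + 1) := by simpa using ord_natCast_nonneg w (k + 1)
  -- `ord s = 0`
  have h4r : (4 : L) * r ^ (2 * k + 1) ≠ 0 := mul_ne_zero h4 (pow_ne_zero _ hr)
  have hord4r : 0 < ord L w (-(4 * r ^ (2 * k + 1))) := by
    rw [ord_neg, ord_mul L w h4 (pow_ne_zero _ hr), ord_pow L w]
    have : (0 : ℤ) < ((2 * k + 1 : ℕ) : ℤ) * ord L w r := by positivity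
    linarith
  have hs2 : ord L w (s ^ 2) = 0 := by
    rw [hcurve, sub_eq_add_neg, ord_add_eq_of_lt w one_ne_zero (neg_ne_zero.2 h4r)
      (by rw [ord_one]; exact hord4r), ord_one]
  have hσ : ord L w s = 0 := by
    rw [ord_pow L w] at hs2
    push_cast at hs2
    omega
  -- the `c`-part has positive order
  set A : L := (k + 1) * r ^ (k + 2) - 2 * r ^ (3 * k + 3) with hA
  by_cases hA0 : A = 0
  · have : N = -s ^ 3 := by rw [hN, hA0, mul_zero, add_zero]
    rw [this, ord_neg, ord_pow L w, hσ, mul_zero]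
  · have hcA : c * A ≠ 0 := mul_ne_zero hc hA0
    have hordA : (k + 2 : ℤ) * ord L w r ≤ ord L w A := by
      have hx : ((k : L) + 1) * r ^ (k + 2) ≠ 0 := mul_ne_zero hk1 (pow_ne_zero _ hr)
      have hy : -(2 * r ^ (3 * k + 3)) ≠ 0 := neg_ne_zero.2 (mul_ne_zero h2 (pow_ne_zero _ hr))
      have hA' : ((k : L) + 1) * r ^ (k + 2) + -(2 * r ^ (3 * k + 3)) ≠ 0 := by
        rw [← sub_eq_add_neg]; exact hA0
      have h := le_ord_add_of_le w (m := (k + 2 : ℤ) * ord L w r) hy hA' (Or.inr ?_) ?_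
      · rw [hA, sub_eq_add_neg]; exact h
      · rw [ord_mul L w hk1 (pow_ne_zero _ hr), ord_pow L w]; push_cast; nlinarith
      · rw [ord_neg, ord_mul L w h2 (pow_ne_zero _ hr), ord_pow L w]; push_cast; nlinarith
    have hordcA : 0 < ord L w (c * A) := by
      rw [ord_mul L w hc hA0]
      have : ord L w r ≤ (k + 2 : ℤ) * ord L w r := by nlinarith
      nlinarith
    have hs3 : -s ^ 3 ≠ 0 := neg_ne_zero.2 (pow_ne_zero _ hs)
    have hos3 : ord L w (-s ^ 3) = 0 := by rw [ord_neg, ord_pow L w, hσ, mul_zero]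
    rw [hN, ord_add_eq_of_lt w hs3 hcA (by rw [hos3]; exact hordcA), hos3]

/-- If `ord_w r` is very NEGATIVE (`r` large: the point is near `Q_∞`), the top term
`−2c·r^{3k+3}` of `N_c` strictly dominates and `ord_w N_c ≤ (M+2)·E` (bounded; `k ≥ 1`).
[cite: MochizukiGenEll2010, Thm 2.1 proof pp.12-13] -/
theorem ord_N_le_of_ord_r_small (k : ℕ) (hk : 1 ≤ k) {c r s N : L} {M E : ℤ} (hE : 1 ≤ E)
    (hM : 0 ≤ M) (hcurve : s ^ 2 = 1 - 4 * r ^ (2 * k + 1))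
    (hN : N = -s ^ 3 + c * ((k + 1) * r ^ (k + 2) - 2 * r ^ (3 * k + 3)))
    (hr : r ≠ 0) (hs : s ≠ 0) (hc : c ≠ 0) (hcu : ord L w c ≤ M * E)
    (ho2 : ord L w (2 : L) ≤ 2 * E) (ho4 : ord L w (4 : L) ≤ 4 * E)
    (hρ : ord L w r ≤ -((M + 2) * E)) : ord L w N ≤ (M + 2) * E := by
  have h4 : (4 : L) ≠ 0 := by norm_num
  have h2 : (2 : L) ≠ 0 := by norm_num
  have hk1 : ((k : L) + 1) ≠ 0 := by exact_mod_cast Nat.succ_ne_zero k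
  have o2 : 0 ≤ ord L w (2 : L) := by simpa using ord_natCast_nonneg w 2
  have o4 : 0 ≤ ord L w (4 : L) := by simpa using ord_natCast_nonneg w 4
  have ok1 : 0 ≤ ord L w ((k : L) + 1) := by simpa using ord_natCast_nonneg w (k + 1)
  have hkz : (1 : ℤ) ≤ k := by exact_mod_cast hk
  set ρ := ord L w r with hρdef
  set γ := ord L w c with hγ
  have hρneg : ρ ≤ -(2 * E) := by nlinarith
  -- `2 ord s = ord 4 + e ρ`
  have h4r : (4 : L) * r ^ (2 * k + 1) ≠ 0 := mul_ne_zero h4 (pow_ne_zero _ hr)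
  have hord4r : ord L w (-(4 * r ^ (2 * k + 1))) = ord L w (4 : L) + ((2 * k + 1 : ℕ) : ℤ) * ρ := by
    rw [ord_neg, ord_mul L w h4 (pow_ne_zero _ hr), ord_pow L w]
  have hlt : ord L w (-(4 * r ^ (2 * k + 1))) < ord L w (1 : L) := by
    rw [hord4r, ord_one]; push_cast
    have : (2 * (k : ℤ) + 1) * ρ ≤ 3 * ρ := by nlinarith
    nlinarith
  have hs2 : 2 * ord L w s = ord L w (4 : L) + ((2 * k + 1 : ℕ) : ℤ) * ρ := by
    have h1 : ord L w (s ^ 2) = ord L w (-(4 * r ^ (2 * k + 1))) := by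
      rw [hcurve, sub_eq_add_neg, add_comm, ord_add_eq_of_lt w (neg_ne_zero.2 h4r) one_ne_zero hlt]
    rw [ord_pow L w] at h1
    rw [← hord4r, ← h1]; push_cast; ring
  -- the three terms
  have hT1 : -s ^ 3 ≠ 0 := neg_ne_zero.2 (pow_ne_zero _ hs)
  have hT2 : c * (((k : L) + 1) * r ^ (k + 2)) ≠ 0 := mul_ne_zero hc (mul_ne_zero hk1 (pow_ne_zero _ hr))
  have hT3 : -(c * (2 * r ^ (3 * k + 3))) ≠ 0 :=
    neg_ne_zero.2 (mul_ne_zero hc (mul_ne_zero h2 (pow_ne_zero _ hr)))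
  have oT1 : 2 * ord L w (-s ^ 3) = 3 * ord L w (4 : L) + 3 * (((2 * k + 1 : ℕ) : ℤ) * ρ) := by
    rw [ord_neg, ord_pow L w]
    have h3 : ((3 : ℕ) : ℤ) * ord L w s = 3 * ord L w s := by norm_num
    rw [h3]; linarith
  have oT2 : ord L w (c * (((k : L) + 1) * r ^ (k + 2))) =
      γ + ord L w ((k : L) + 1) + ((k + 2 : ℕ) : ℤ) * ρ := by
    rw [ord_mul L w hc (mul_ne_zero hk1 (pow_ne_zero _ hr)), ord_mul L w hk1 (pow_ne_zero _ hr),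
      ord_pow L w]; ring
  have oT3 : ord L w (-(c * (2 * r ^ (3 * k + 3)))) = ord L w (2 : L) + γ + ((3 * k + 3 : ℕ) : ℤ) * ρ := by
    rw [ord_neg, ord_mul L w hc (mul_ne_zero h2 (pow_ne_zero _ hr)), ord_mul L w h2 (pow_ne_zero _ hr),
      ord_pow L w]; ring
  -- dominance
  have d32 : ord L w (-(c * (2 * r ^ (3 * k + 3)))) < ord L w (c * (((k : L) + 1) * r ^ (k + 2))) := by
    rw [oT2, oT3]; push_cast
    have : (2 * (k : ℤ) + 1) * ρ ≤ 3 * ρ := by nlinarith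
    nlinarith
  have d31 : ord L w (-(c * (2 * r ^ (3 * k + 3)))) < ord L w (-s ^ 3) := by
    have h := oT1
    rw [oT3]; push_cast at h ⊢
    nlinarith
  have hsum23 : c * (((k : L) + 1) * r ^ (k + 2)) + -(c * (2 * r ^ (3 * k + 3))) ≠ 0 := by
    intro h0
    have e : c * (((k : L) + 1) * r ^ (k + 2)) = -(-(c * (2 * r ^ (3 * k + 3)))) := by
      rw [neg_neg]; linear_combination h0
    have := congrArg (ord L w) e
    rw [ord_neg] at this
    exact d32.ne this.symm
  have o23 : ord L w (c * (((k : L) + 1) * r ^ (k + 2)) + -(c * (2 * r ^ (3 * k + 3)))) =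
      ord L w (-(c * (2 * r ^ (3 * k + 3)))) := by
    rw [add_comm, ord_add_eq_of_lt w hT3 hT2 d32]
  have hNeq : N = -s ^ 3 + (c * (((k : L) + 1) * r ^ (k + 2)) + -(c * (2 * r ^ (3 * k + 3)))) := by
    rw [hN]; ring
  rw [hNeq, add_comm, ord_add_eq_of_lt w hsum23 hT1 (by rw [o23]; exact d31), o23, oT3]
  push_cast
  nlinarith

/-- `2·ord_w s` is bounded below by `min(0, ord_w 4 + e·ord_w r)` (from `s² = 1 − 4r^e`).
[cite: MochizukiGenEll2010, Thm 2.1 proof pp.12-13] -/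
theorem two_mul_ord_s_ge (k : ℕ) {r s : L} (hcurve : s ^ 2 = 1 - 4 * r ^ (2 * k + 1))
    (hr : r ≠ 0) (hs : s ≠ 0) :
    min 0 (ord L w (4 : L) + ((2 * k + 1 : ℕ) : ℤ) * ord L w r) ≤ 2 * ord L w s := by
  have h4 : (4 : L) ≠ 0 := by norm_num
  have h4r : -((4 : L) * r ^ (2 * k + 1)) ≠ 0 := neg_ne_zero.2 (mul_ne_zero h4 (pow_ne_zero _ hr))
  have hs2 : (1 : L) + -(4 * r ^ (2 * k + 1)) ≠ 0 := by
    rw [← sub_eq_add_neg, ← hcurve]; exact pow_ne_zero _ hs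
  have h := min_ord_le_ord_add w one_ne_zero h4r hs2
  rw [ord_one, ord_neg, ord_mul L w h4 (pow_ne_zero _ hr), ord_pow L w, ← sub_eq_add_neg, ← hcurve,
    ord_pow L w] at h
  push_cast at h ⊢
  linarith

/-- If `ord_w r` is bounded and `ord_w s` is LARGE (the point is near a Weierstrass point `s = 0`), the
term `(2k+1)·c·r^{k+2}` of `2N_c = −2s³ + (2k+1)c·r^{k+2} + c·r^{k+2}s²` strictly dominates and
`ord_w N_c` is bounded. [cite: MochizukiGenEll2010, Thm 2.1 proof pp.12-13] -/
theorem ord_N_le_of_ord_s_large (k : ℕ) {c r s N : L} {R M E : ℤ} (hE : 1 ≤ E) (hR : 0 ≤ R)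
    (hM : 0 ≤ M) (hcurve : s ^ 2 = 1 - 4 * r ^ (2 * k + 1))
    (hN : N = -s ^ 3 + c * ((k + 1) * r ^ (k + 2) - 2 * r ^ (3 * k + 3)))
    (hr : r ≠ 0) (hs : s ≠ 0) (hN0 : N ≠ 0) (hc : c ≠ 0) (hcu : ord L w c ≤ M * E)
    (ho : ord L w (((2 * k + 1 : ℕ) : L)) ≤ (2 * k + 1) * E)
    (hρ : ord L w r ≤ R * E)
    (hσ : ((2 * k + 1) + M + (k + 2) * R) * E < ord L w s) :
    ord L w N ≤ ((2 * k + 1) + M + (k + 2) * R) * E := by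
  have h2 : (2 : L) ≠ 0 := by norm_num
  have he : (((2 * k + 1 : ℕ) : L)) ≠ 0 := by exact_mod_cast Nat.succ_ne_zero (2 * k)
  have o2 : 0 ≤ ord L w (2 : L) := by simpa using ord_natCast_nonneg w 2
  have oe : 0 ≤ ord L w (((2 * k + 1 : ℕ) : L)) := ord_natCast_nonneg w (2 * k + 1)
  set ρ := ord L w r with hρdef
  set σ := ord L w s with hσdef
  set γ := ord L w c with hγ
  have hKR : 0 ≤ ((k : ℤ) + 2) * R := by nlinarith
  have hσpos : 0 < σ := by nlinarith
  -- `2N = U1 + U2 + U3`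
  have h2N : 2 * N = -(2 * s ^ 3) + ((((2 * k + 1 : ℕ) : L)) * c * r ^ (k + 2) + c * r ^ (k + 2) * s ^ 2) := by
    rw [hN]; push_cast
    linear_combination (-(c * r ^ (k + 2))) * hcurve
  have hU1 : -(2 * s ^ 3) ≠ 0 := neg_ne_zero.2 (mul_ne_zero h2 (pow_ne_zero _ hs))
  have hU2 : (((2 * k + 1 : ℕ) : L)) * c * r ^ (k + 2) ≠ 0 := mul_ne_zero (mul_ne_zero he hc) (pow_ne_zero _ hr)
  have hU3 : c * r ^ (k + 2) * s ^ 2 ≠ 0 := mul_ne_zero (mul_ne_zero hc (pow_ne_zero _ hr)) (pow_ne_zero _ hs)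
  have oU1 : ord L w (-(2 * s ^ 3)) = ord L w (2 : L) + 3 * σ := by
    rw [ord_neg, ord_mul L w h2 (pow_ne_zero _ hs), ord_pow L w]; push_cast; ring
  have oU2 : ord L w ((((2 * k + 1 : ℕ) : L)) * c * r ^ (k + 2)) =
      ord L w (((2 * k + 1 : ℕ) : L)) + γ + ((k + 2 : ℕ) : ℤ) * ρ := by
    rw [ord_mul L w (mul_ne_zero he hc) (pow_ne_zero _ hr), ord_mul L w he hc, ord_pow L w]
  have oU3 : ord L w (c * r ^ (k + 2) * s ^ 2) = γ + ((k + 2 : ℕ) : ℤ) * ρ + 2 * σ := by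
    rw [ord_mul L w (mul_ne_zero hc (pow_ne_zero _ hr)) (pow_ne_zero _ hs),
      ord_mul L w hc (pow_ne_zero _ hr), ord_pow L w, ord_pow L w]; push_cast; ring
  have hcast : ((k + 2 : ℕ) : ℤ) = (k : ℤ) + 2 := by push_cast; ring
  have hμ : ord L w (((2 * k + 1 : ℕ) : L)) + γ + ((k + 2 : ℕ) : ℤ) * ρ ≤ ((2 * k + 1) + M + (k + 2) * R) * E := by
    rw [hcast]
    have : ((k : ℤ) + 2) * ρ ≤ (k + 2) * (R * E) := by nlinarith
    nlinarith
  have d23 : ord L w ((((2 * k + 1 : ℕ) : L)) * c * r ^ (k + 2)) < ord L w (c * r ^ (k + 2) * s ^ 2) := by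
    rw [oU2, oU3]
    have : ord L w (((2 * k + 1 : ℕ) : L)) < 2 * σ := by nlinarith
    linarith
  have d21 : ord L w ((((2 * k + 1 : ℕ) : L)) * c * r ^ (k + 2)) < ord L w (-(2 * s ^ 3)) := by
    rw [oU2, oU1]; nlinarith
  have hsum : (((2 * k + 1 : ℕ) : L)) * c * r ^ (k + 2) + c * r ^ (k + 2) * s ^ 2 ≠ 0 := by
    intro h0
    have e : c * r ^ (k + 2) * s ^ 2 = -((((2 * k + 1 : ℕ) : L)) * c * r ^ (k + 2)) := by
      linear_combination h0
    have := congrArg (ord L w) e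
    rw [ord_neg] at this
    exact d23.ne this.symm
  have o23 : ord L w ((((2 * k + 1 : ℕ) : L)) * c * r ^ (k + 2) + c * r ^ (k + 2) * s ^ 2) =
      ord L w ((((2 * k + 1 : ℕ) : L)) * c * r ^ (k + 2)) := ord_add_eq_of_lt w hU2 hU3 d23
  have o2N : ord L w (2 * N) = ord L w ((((2 * k + 1 : ℕ) : L)) * c * r ^ (k + 2)) := by
    rw [h2N, add_comm, ord_add_eq_of_lt w hsum hU1 (by rw [o23]; exact d21), o23]
  rw [ord_mul L w h2 hN0] at o2N
  rw [oU2] at o2N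
  linarith

end DeDefect

/-! ## The defect inequality at every place -/

/-- **[GenEll] Thm. 2.1 on `D_e`, the sharp conductor inequality with a defect at EVERY place (piece
(F-b) of the R-b-with-defects resolution).**  For the family data `(k ≥ 1, c ≠ 0)`, a finite set
`A ⊂ K` of values (the critical values of `t_c`) and polynomials `H₀, H₁ ∈ K[X]` (the certificate of
the Dedekind-ring divisibility `N_c ∣ ∏_{β∈A}(s + c·r^{k+2} − β·rs)`), there is `D ∈ ℕ` such that for
EVERY number field `L ⊇ K`, EVERY finite place `w ∣ p` of `L` and EVERY point `(r, s)` of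
`D_e ∖ {rs = 0}` (`s² = 1 − 4r^{2k+1}`) with `t·(rs) = s + c·r^{k+2}`, `N_c ≠ 0`, `t ∉ A` at which the
divisibility identity holds,

  `ord⁺_w N_c ≤ Σ_{β∈A} ord⁺_w (t − β) + D · e(w∣p)`.

No `p`-adic separation, no good reduction at `w` (the hypothesis `hdef`/`hδ` of the defect form of the
conductor summation).  The constant depends only on `(p, k, c, A, H₀, H₁)`.
[cite: MochizukiGenEll2010, Thm 2.1 proof pp.12-13] -/
theorem DeC.exists_defect_toNat_ord_le (p : ℕ) [Fact p.Prime] (k : ℕ) (hk : 1 ≤ k)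
    {K : Type*} [Field K] [NumberField K] {c : K} (hc : c ≠ 0) (A : Finset K) (H₀ H₁ : K[X]) :
    ∃ D : ℕ, ∀ (L : Type*) [Field L] [NumberField L] [Algebra K L]
      (w : HeightOneSpectrum (𝓞 L)), w ∈ placesOver L p → ∀ (r s t N : L),
      s ^ 2 = 1 - 4 * r ^ (2 * k + 1) → t * (r * s) = s + algebraMap K L c * r ^ (k + 2) →
      N = -s ^ 3 + algebraMap K L c * ((k + 1) * r ^ (k + 2) - 2 * r ^ (3 * k + 3)) →
      r ≠ 0 → s ≠ 0 → N ≠ 0 → (∀ β ∈ A, t ≠ algebraMap K L β) →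
      (∏ β ∈ A, (s + algebraMap K L c * r ^ (k + 2) - algebraMap K L β * (r * s)) =
        N * (aeval r (H₀.map (algebraMap K L)) + s * aeval r (H₁.map (algebraMap K L)))) →
      (ord L w N).toNat ≤ (∑ β ∈ A, (ord L w (t - algebraMap K L β)).toNat) + D * ramIdx L w := by
  classical
  -- one integer clearing the denominators of `c`, `c⁻¹` and of the coefficients of `H₀`, `H₁`
  obtain ⟨y, hy, hyint⟩ :=
    exists_integral_multiples ℤ ℚ (({c, c⁻¹} : Finset K) ∪ H₀.coeffs ∪ H₁.coeffs)
  -- the constants (all natural numbers)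
  refine ⟨(y.natAbs + 2) + ((2 * k + 1) + y.natAbs + (k + 2) * (y.natAbs + 2)) +
    (A.card * ((y.natAbs + 2) + ((2 * k + 1) + y.natAbs + (k + 2) * (y.natAbs + 2))) + y.natAbs +
      (H₀.natDegree + H₁.natDegree) * (y.natAbs + 2) + (2 * k + 1) * (y.natAbs + 2)), ?_⟩
  intro L _ _ _ w hw r s t N hcurve ht hN hr hs hN0 htA hH
  rw [Int.toNat_le]
  push_cast
  -- abbreviations
  set E : ℤ := (ramIdx L w : ℤ) with hEdef
  set M : ℤ := |y| with hMdef
  set R : ℤ := M + 2 with hRdef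
  set Sx : ℤ := (2 * k + 1) + M + (k + 2) * R with hSxdef
  set Sm : ℤ := (2 * k + 1) * R with hSmdef
  set Q : ℤ := A.card * (R + Sx) + M + (H₀.natDegree + H₁.natDegree) * R + Sm with hQdef
  set Spos : ℤ := ∑ β ∈ A, ((ord L w (t - algebraMap K L β)).toNat : ℤ) with hSpos
  have hE1 : (1 : ℤ) ≤ E := by
    have := ramIdx_ne_zero L w
    rw [hEdef]; exact_mod_cast Nat.one_le_iff_ne_zero.mpr this
  have hE0 : (0 : ℤ) ≤ E := by linarith
  have hM0 : (0 : ℤ) ≤ M := abs_nonneg y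
  have hk0 : (0 : ℤ) ≤ k := Nat.cast_nonneg _
  have hR0 : (0 : ℤ) ≤ R := by rw [hRdef]; linarith
  have hSx0 : (0 : ℤ) ≤ Sx := by rw [hSxdef]; positivity
  have hSm0 : (0 : ℤ) ≤ Sm := by rw [hSmdef]; positivity
  have hQ0 : (0 : ℤ) ≤ Q := by rw [hQdef]; positivity
  have hSpos0 : 0 ≤ Spos := Finset.sum_nonneg fun β _ => Int.natCast_nonneg _
  -- the goal is `ord N ≤ Spos + (R + Sx + Q) * E`
  change ord L w N ≤ Spos + (R + Sx + Q) * E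
  -- integrality facts
  have hsmul : ∀ x : K, y • x = (y : K) * x := fun x => by
    rw [Algebra.smul_def, eq_intCast]
  have hcmem : c ∈ (({c, c⁻¹} : Finset K) ∪ H₀.coeffs ∪ H₁.coeffs) :=
    Finset.mem_union_left _ (Finset.mem_union_left _ (by simp))
  have hcimem : c⁻¹ ∈ (({c, c⁻¹} : Finset K) ∪ H₀.coeffs ∪ H₁.coeffs) :=
    Finset.mem_union_left _ (Finset.mem_union_left _ (by simp))
  have hic : IsIntegral ℤ ((y : K) * c) := by rw [← hsmul]; exact hyint c hcmem
  have hici : IsIntegral ℤ ((y : K) * c⁻¹) := by rw [← hsmul]; exact hyint _ hcimem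
  set c' : L := algebraMap K L c with hc'def
  have hc' : c' ≠ 0 := (_root_.map_ne_zero _).2 hc
  have hcl : -(M * E) ≤ ord L w c' := by
    have := DeDefect.neg_le_ord_algebraMap w p hw hc hy hic
    rwa [Int.natCast_natAbs] at this
  have hcu : ord L w c' ≤ M * E := by
    have := DeDefect.ord_algebraMap_le w p hw hc hy hici
    rwa [Int.natCast_natAbs] at this
  have ho2 : ord L w (2 : L) ≤ 2 * E := by
    have := DeDefect.ord_natCast_le w p hw (n := 2) (by norm_num); simpa using this
  have ho4 : ord L w (4 : L) ≤ 4 * E := by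
    have := DeDefect.ord_natCast_le w p hw (n := 4) (by norm_num); simpa using this
  have ho4' : 0 ≤ ord L w (4 : L) := by simpa using DeDefect.ord_natCast_nonneg w 4
  have hoe : ord L w (((2 * k + 1 : ℕ) : L)) ≤ (2 * k + 1) * E := by
    have := DeDefect.ord_natCast_le w p hw (Nat.succ_ne_zero (2 * k))
    push_cast at this ⊢; exact this
  -- case analysis on `ord r`
  by_cases hρ₁ : M * E < ord L w r
  · -- `r ≡ 0` deeply at `w`: `N` is a unit
    have h0 := DeDefect.ord_N_eq_zero_of_ord_r_large w k hE0 hM0 hcurve hN hr hs hc' hcl hρ₁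
    rw [h0]
    have : (0 : ℤ) ≤ (R + Sx + Q) * E := mul_nonneg (by linarith) hE0
    linarith
  by_cases hρ₂ : ord L w r ≤ -((M + 2) * E)
  · -- `r` large at `w`
    have h := DeDefect.ord_N_le_of_ord_r_small w k hk hE1 hM0 hcurve hN hr hs hc' hcu ho2 ho4 hρ₂
    have : (M + 2) * E ≤ (R + Sx + Q) * E :=
      mul_le_mul_of_nonneg_right (by rw [hRdef]; linarith) hE0
    linarith
  -- `ord r` pinned
  push Not at hρ₁ hρ₂
  have hρl : -(R * E) ≤ ord L w r := by rw [hRdef]; linarith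
  have hρu : ord L w r ≤ R * E := by rw [hRdef]; nlinarith
  by_cases hσ₁ : ((2 * k + 1) + M + (k + 2) * R) * E < ord L w s
  · -- `s` small at `w` (near a Weierstrass point)
    have h := DeDefect.ord_N_le_of_ord_s_large w k hE1 hR0 hM0 hcurve hN hr hs hN0 hc' hcu hoe hρu hσ₁
    have : ((2 * k + 1) + M + (k + 2) * R) * E ≤ (R + Sx + Q) * E :=
      mul_le_mul_of_nonneg_right (by rw [hSxdef]; linarith) hE0
    linarith
  -- pinned: the identity
  push Not at hσ₁
  have hσu : ord L w s ≤ Sx * E := by rw [hSxdef]; exact hσ₁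
  have hσl : -(Sm * E) ≤ ord L w s := by
    have h := DeDefect.two_mul_ord_s_ge w k hcurve hr hs
    have hmin : -((2 * (k : ℤ) + 1) * R * E) ≤
        min 0 (ord L w (4 : L) + ((2 * k + 1 : ℕ) : ℤ) * ord L w r) := by
      rw [le_min_iff]; constructor
      · have : (0 : ℤ) ≤ (2 * (k : ℤ) + 1) * R * E := by positivity
        linarith
      · push_cast
        have : (2 * (k : ℤ) + 1) * (-(R * E)) ≤ (2 * (k : ℤ) + 1) * ord L w r :=
          mul_le_mul_of_nonneg_left hρl (by positivity)
        linarith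
    rw [hSmdef]
    have : (0 : ℤ) ≤ (2 * (k : ℤ) + 1) * R * E := by positivity
    linarith
  -- coefficient bounds
  have hcoeff : ∀ (P : K[X]), P.coeffs ⊆ (({c, c⁻¹} : Finset K) ∪ H₀.coeffs ∪ H₁.coeffs) →
      ∀ n, (P.map (algebraMap K L)).coeff n ≠ 0 →
        -(M * E) ≤ ord L w ((P.map (algebraMap K L)).coeff n) := by
    intro P hP n hn
    rw [coeff_map] at hn ⊢
    have hn' : P.coeff n ≠ 0 := fun h => hn (by rw [h, map_zero])
    have hint : IsIntegral ℤ ((y : K) * P.coeff n) := by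
      rw [← hsmul]; exact hyint _ (hP (coeff_mem_coeffs hn'))
    have := DeDefect.neg_le_ord_algebraMap w p hw hn' hy hint
    rwa [Int.natCast_natAbs] at this
  have hsub₀ : H₀.coeffs ⊆ (({c, c⁻¹} : Finset K) ∪ H₀.coeffs ∪ H₁.coeffs) :=
    fun x hx => Finset.mem_union_left _ (Finset.mem_union_right _ hx)
  have hsub₁ : H₁.coeffs ⊆ (({c, c⁻¹} : Finset K) ∪ H₀.coeffs ∪ H₁.coeffs) :=
    fun x hx => Finset.mem_union_right _ hx
  have key := DeDefect.ord_N_le_of_identity w k A (H₀.map (algebraMap K L))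
    (H₁.map (algebraMap K L)) hE0 hR0 hSm0 ht hr hs hN0 htA hH hρl hρu hσl hσu
    (hcoeff H₀ hsub₀) (hcoeff H₁ hsub₁)
  rw [natDegree_map_eq_of_injective (algebraMap K L).injective,
    natDegree_map_eq_of_injective (algebraMap K L).injective] at key
  have hQ : ord L w N ≤ Spos + Q * E := by rw [hQdef, hSpos]; linarith
  have : Q * E ≤ (R + Sx + Q) * E := mul_le_mul_of_nonneg_right (by linarith) hE0
  linarith

end Literature.NumberTheory.DiophantineGeometry.GenEll
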